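import Literature.AnabelianGeometry.SemiGraphs.Commensurability
import HarnessLib

/-!
# [SemiAnbd] Def 2.3 (iii): collections of finite étale coverings of bounded degree — NON-VACUITY of the
# interface `SemiGraphOfAnabelioids.CoveringCollection` (abc-iut L3 inhabitation census v1: zero producers)

Mochizuki, *Semi-graphs of anabelioids*, Publ. RIMS **42** (2006), §2, Definition 2.3 (iii), p. 25 (PRIMS
p. 245) [cite: MochizukiSemiAnbd2006, Def. 2.3(iii) p.25]: quasi-coherence quantifies over «collections of
finite étale coverings `ℋ_c → 𝒢_c` of degree `≤ M`».  abc-iut-L3-t1's group-theoretic record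
`CoveringCollection 𝒢 M` (`Commensurability.lean`: basepoints of all constituents + open subgroups of index
`≤ M`) had no producer, so the quantifier domain of `IsQuasiCoherent` was never shown nonempty in the kernel.

PROOF-ONLY file (abc-iut cell, wave-4 prover abc-iut-w4-d098; no `def`/`instance`/`structure`):
`CoveringCollection.nonempty_trivial` — for EVERY semi-graph of anabelioids `𝒢` and every `M ≥ 1`, the
collection of TRIVIAL (degree-`1`) coverings: basepoints from Mathlib's `GaloisCategory.hasFiberFunctor`
(every constituent anabelioid is a Galois category, hence has a fibre functor), all subgroups `⊤` (open, index
`1 ≤ M`).  GENUINE (it is a collection print allows) but the least interesting one — labelled «trivial».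
Nothing here bears on [IUTchIII] Cor. 3.12.
-/

namespace Literature.AnabelianGeometry.SemiGraphs

open CategoryTheory PreGaloisCategory

universe v₁ u₁ u

/-- **The trivial covering collection** (all coverings of degree `1`) inhabits `CoveringCollection 𝒢 M` for
every `𝒢` and every `M ≥ 1`. [cite: MochizukiSemiAnbd2006, Def. 2.3(iii) p.25] -/
theorem SemiGraphOfAnabelioids.CoveringCollection.nonempty_trivial (𝒢 : SemiGraphOfAnabelioids.{v₁, u₁, u})
    {M : ℕ} (hM : 1 ≤ M) : Nonempty (SemiGraphOfAnabelioids.CoveringCollection 𝒢 M) := by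
  classical
  have hV : ∀ v : 𝒢.graph.Vertex, ∃ F : 𝒢.V v ⥤ FintypeCat.{v₁}, Nonempty (FiberFunctor F) :=
    fun v => GaloisCategory.hasFiberFunctor
  have hE : ∀ e : 𝒢.graph.Edge, ∃ F : 𝒢.E e ⥤ FintypeCat.{v₁}, Nonempty (FiberFunctor F) :=
    fun e => GaloisCategory.hasFiberFunctor
  choose FV hFV using hV
  choose FE hFE using hE
  exact ⟨{ FV := FV
           fiberV := fun v => (hFV v).some
           FE := FE
           fiberE := fun e => (hFE e).some
           UV := fun _ => ⊤
           UE := fun _ => ⊤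
           isOpen_UV := fun _ => by rw [Subgroup.coe_top]; exact isOpen_univ
           isOpen_UE := fun _ => by rw [Subgroup.coe_top]; exact isOpen_univ
           index_UV := fun _ => by rw [Subgroup.index_top]; exact hM
           index_UE := fun _ => by rw [Subgroup.index_top]; exact hM }⟩

end Literature.AnabelianGeometry.SemiGraphs
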